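import Mathlib
import HarnessLib
import Summits.ValiantsHypothesis.ValiantsHypothesis.Theses.MonotoneRestoration
import Literature.Computability.AlgebraicComplexity.PatternExpressions
import Literature.Computability.AlgebraicComplexity.DawarWilsenach2025
import Literature.Combinatorics.SimpleGraph.TreeDecomposition

/-!
# Route MonotoneRestoration — crux `OrbitRestorationQP` (stmt-ValiantsHypothesis-18293): the typed split
`NarrowExpansionVP → HomPolyClose → CloseOrbit → OrbitRestorationQP` (crux-strategist, line `narrow-expansion`)

The crux `OrbitRestorationQP` (every matrix-symmetric `VP` family over `ℂ` has square-symmetric circuits of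
quasi-polynomial ORBIT size) bounds orbits, not size, so its converse engine needs no complexity measure and
the crux factors through a statement of pure linear algebra plus two folklore bridges:

* `NarrowExpansionVP` (sub-crux 1, conjecture-grade, the content): every matrix-symmetric `VP` family lies,
  for every `n`, in the `ℂ`-span of the homomorphism polynomials `hom_{F,n}` (`homPoly`) of bipartite
  multigraph patterns whose pattern graph has treewidth `≤ (log₂ n + c)^c` — the quasi-polynomial-scale,
  circuit-free form of Dawar–Pago–Seppelt's characterisation `𝔗^k =` polynomial-orbit symmetric circuits
  (ICALP 2025, Thm 1.1) and of Dwivedi–Pago–Seppelt's Outlook Q3 (2026);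
* `HomPolyClose` (sub-crux 2, folklore, provable): a pattern of treewidth `≤ w` is, for `n ≥ 1` and any
  `k, l ≥ w + 1` labels, the closed polynomial of a labelled pattern expression (`PatternExpr.close`);
* `CloseOrbit` (sub-crux 3, folklore, provable): the closed polynomial of any expression with `k + l` labels
  has a square-symmetric circuit all of whose gate orbits have size `≤ (n+1)^(k+l+2)`, whatever its length;
* `orbitRestorationQP_of_narrowExpansion : NarrowExpansionVP → HomPolyClose → CloseOrbit → OrbitRestorationQP`
  (the three statements spelled out verbatim, no new `def`) — proved: `Submodule.span_induction` fuses a span certificate into ONE expression (`close` is linear),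
  sub-crux 3 gives the circuit, and `(n+1)^(2W+2) ≤ 2^((log₂ n + c + 3)^(c+3))` for `W = (log₂ n + c)^c + 1`;
  `n = 0` is a constant (`MvPolynomial.eq_C_of_isEmpty`).

The three sub-crux statements are, verbatim, the registered stubs `stub_narrowExpansionVP`,
`stub_homPoly_close`, `stub_close_orbit` of `Cruxes/OrbitRestorationQP/Lines/narrow_expansion.lean`
(names `NarrowExpansionVP`, `HomPolyClose`, `CloseOrbit` are the proposed split children of the route item).

## References
* A. Dawar, B. Pago, T. Seppelt, *Symmetric algebraic circuits and homomorphism polynomials*, ICALP 2025,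
  arXiv:2502.06740, Thm 1.1, Thm 5.3, §5.6, Thm 6.2/6.3. [DawarPagoSeppelt2025]
* P. Dwivedi, B. Pago, T. Seppelt, arXiv:2601.09343 (2026), eq. (1), Cor 3.6, Thm 3.8, Outlook Q3.
  [DwivediPagoSeppelt2026]
* A. Dawar, G. Wilsenach, *Symmetric arithmetic circuits*, ToC 2025, §3.3, Thm 7.1. [DawarWilsenach2025]
-/

noncomputable section

set_option linter.dupNamespace false

namespace Summit.ValiantsHypothesis.ValiantsHypothesis.Theorems

open Summit.ValiantsHypothesis.ValiantsHypothesis.Theses.MonotoneRestoration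
open Literature.Computability.AlgebraicComplexity

/-! ### Glue: linearity of `close`, the constant case, the exponent arithmetic -/

/-- `close` of the zero constant is `0`. [folklore] -/
theorem narrowExpansion_close_zero (n k l : ℕ) : (PatternExpr.const 0 : PatternExpr ℂ k l).close n = 0 := by
  simp [PatternExpr.close]

/-- `close` is additive. [folklore] -/
theorem narrowExpansion_close_add (n k l : ℕ) (e₁ e₂ : PatternExpr ℂ k l) :
    (PatternExpr.add e₁ e₂).close n = e₁.close n + e₂.close n := by
  simp only [PatternExpr.close, PatternExpr.value_add, Finset.sum_add_distrib]

/-- `close` of `const a · e` is `a • close e`. [folklore] -/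
theorem narrowExpansion_close_smul (n k l : ℕ) (a : ℂ) (e : PatternExpr ℂ k l) :
    (PatternExpr.mul (PatternExpr.const a) e).close n = a • e.close n := by
  simp only [PatternExpr.close, PatternExpr.value_mul, PatternExpr.value_const, Finset.smul_sum,
    MvPolynomial.smul_eq_C_mul]

/-- With no labels and `n = 0`, `close` of a constant is that constant. [folklore] -/
theorem narrowExpansion_close_const (r : ℂ) :
    (PatternExpr.const r : PatternExpr ℂ 0 0).close 0 = MvPolynomial.C r := by
  simp [PatternExpr.close]

/-- A span certificate over the narrow patterns is ONE narrow expression (given K2). [folklore] -/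
theorem narrowExpansion_exists_expr (h₂ : ∀ (a b w : ℕ) (E : Multiset (Fin a × Fin b)),
      Literature.Combinatorics.SimpleGraph.treewidth
          (SimpleGraph.fromRel fun u v : Fin a ⊕ Fin b =>
            ∃ e ∈ E, u = Sum.inl e.1 ∧ v = Sum.inr e.2) ≤ w →
      ∀ n : ℕ, 1 ≤ n → ∀ k l : ℕ, w + 1 ≤ k → w + 1 ≤ l →
        ∃ e : PatternExpr ℂ k l, e.close n = homPoly E n ℂ)
    (n w : ℕ) (hn : 1 ≤ n) (p : MvPolynomial (Fin n × Fin n) ℂ)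
    (hp : p ∈ Submodule.span ℂ
        {p : MvPolynomial (Fin n × Fin n) ℂ | ∃ (a b : ℕ) (E : Multiset (Fin a × Fin b)),
          Literature.Combinatorics.SimpleGraph.treewidth
              (SimpleGraph.fromRel fun u v : Fin a ⊕ Fin b =>
                ∃ e ∈ E, u = Sum.inl e.1 ∧ v = Sum.inr e.2) ≤ w ∧
            p = homPoly E n ℂ}) :
    ∃ e : PatternExpr ℂ (w + 1) (w + 1), e.close n = p := by
  induction hp using Submodule.span_induction with
  | mem p hp =>
    obtain ⟨a, b, E, htw, rfl⟩ := hp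
    exact h₂ a b w E htw n hn (w + 1) (w + 1) le_rfl le_rfl
  | zero => exact ⟨PatternExpr.const 0, narrowExpansion_close_zero n _ _⟩
  | add p q _ _ hp hq =>
    obtain ⟨e₁, he₁⟩ := hp
    obtain ⟨e₂, he₂⟩ := hq
    exact ⟨PatternExpr.add e₁ e₂, by rw [narrowExpansion_close_add, he₁, he₂]⟩
  | smul a p _ hp =>
    obtain ⟨e, he⟩ := hp
    exact ⟨PatternExpr.mul (PatternExpr.const a) e, by rw [narrowExpansion_close_smul, he]⟩

/-- The exponent arithmetic: `(L+1)(2(L+c)^c + 4) ≤ (L+c+3)^(c+3)`. [folklore] -/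
theorem narrowExpansion_width_arith (L c : ℕ) : (L + 1) * (2 * (L + c) ^ c + 4) ≤ (L + (c + 3)) ^ (c + 3) := by
  set m := L + (c + 3) with hm
  have h1 : (L + c) ^ c ≤ m ^ c := Nat.pow_le_pow_left (by omega) c
  have h2 : 1 ≤ m ^ c := Nat.one_le_pow _ _ (by omega)
  have h3 : 9 ≤ m * m := by nlinarith
  calc (L + 1) * (2 * (L + c) ^ c + 4) ≤ m * (9 * m ^ c) := Nat.mul_le_mul (by omega) (by omega)
    _ ≤ m * (m * m * m ^ c) := Nat.mul_le_mul_left _ (Nat.mul_le_mul_right _ h3)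
    _ = m ^ (c + 3) := by ring

/-- The orbit bound of the assembled circuit is quasi-polynomial:
`(n+1)^(W + W + 2) ≤ 2^((log₂ n + c + 3)^(c+3))` for `W = (log₂ n + c)^c + 1`. [folklore] -/
theorem narrowExpansion_orbit_bound (n c : ℕ) :
    (n + 1) ^ ((Nat.log 2 n + c) ^ c + 1 + ((Nat.log 2 n + c) ^ c + 1) + 2) ≤
      2 ^ ((Nat.log 2 n + (c + 3)) ^ (c + 3)) := by
  have hL : n < 2 ^ (Nat.log 2 n + 1) := Nat.lt_pow_succ_log_self Nat.one_lt_two n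
  generalize Nat.log 2 n = L at hL ⊢
  have hn1 : n + 1 ≤ 2 ^ (L + 1) := hL
  calc (n + 1) ^ ((L + c) ^ c + 1 + ((L + c) ^ c + 1) + 2)
      ≤ (2 ^ (L + 1)) ^ ((L + c) ^ c + 1 + ((L + c) ^ c + 1) + 2) := Nat.pow_le_pow_left hn1 _
    _ = 2 ^ ((L + 1) * (2 * (L + c) ^ c + 4)) := by rw [← pow_mul]; congr 1; ring
    _ ≤ 2 ^ ((L + (c + 3)) ^ (c + 3)) := Nat.pow_le_pow_right (by norm_num) (narrowExpansion_width_arith L c)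

/-! ### The split implication -/

/-- **The typed split of the crux** `OrbitRestorationQP` (stmt-ValiantsHypothesis-18293) into the three
registered stubs of line `narrow-expansion`, verbatim: NARROW HOM-EXPANSION (`stub_narrowExpansionVP`) →
TREEWIDTH-TO-EXPRESSION (`stub_homPoly_close`) → LENGTH-FREE ORBIT BOUND (`stub_close_orbit`) →
`OrbitRestorationQP`.  Expand `f n` in the narrow span, realise the span certificate as one labelled pattern
expression with `(log₂ n + c)^c + 1` labels a side (`close` is linear), build the length-free symmetric
circuit and bound `(n+1)^(2W+2)` by `2^((log₂ n + c + 3)^(c+3))`; `n = 0` is a constant. [this file] -/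
theorem orbitRestorationQP_of_narrowExpansion :

    (∀ f : (n : ℕ) → MvPolynomial (Fin n × Fin n) ℂ,
      (∀ (n : ℕ) (σ τ : Equiv.Perm (Fin n)),
        MvPolynomial.rename (fun p : Fin n × Fin n => (σ p.1, τ p.2)) (f n) = f n) →
      IsVPFamily f →
      ∃ c : ℕ, ∀ n : ℕ, f n ∈ Submodule.span ℂ
        {p : MvPolynomial (Fin n × Fin n) ℂ | ∃ (a b : ℕ) (E : Multiset (Fin a × Fin b)),
          Literature.Combinatorics.SimpleGraph.treewidth
              (SimpleGraph.fromRel fun u v : Fin a ⊕ Fin b =>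
                ∃ e ∈ E, u = Sum.inl e.1 ∧ v = Sum.inr e.2) ≤ (Nat.log 2 n + c) ^ c ∧
            p = homPoly E n ℂ}) →
    (∀ (a b w : ℕ) (E : Multiset (Fin a × Fin b)),
      Literature.Combinatorics.SimpleGraph.treewidth
          (SimpleGraph.fromRel fun u v : Fin a ⊕ Fin b =>
            ∃ e ∈ E, u = Sum.inl e.1 ∧ v = Sum.inr e.2) ≤ w →
      ∀ n : ℕ, 1 ≤ n → ∀ k l : ℕ, w + 1 ≤ k → w + 1 ≤ l →
        ∃ e : PatternExpr ℂ k l, e.close n = homPoly E n ℂ) →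
    (∀ (n k l : ℕ) (e : PatternExpr ℂ k l),
      ∃ (G : Type) (_ : Fintype G) (C : LabelledArithCircuit ℂ (Fin n × Fin n) Unit G),
        C.IsSymmetric (Equiv.Perm (Fin n)) ∧ C.eval (C.output ()) = e.close n ∧
          C.orbitSize (Equiv.Perm (Fin n)) ≤ (n + 1) ^ (k + l + 2)) →
    Summit.ValiantsHypothesis.ValiantsHypothesis.Theses.MonotoneRestoration.OrbitRestorationQP := by
  intro h₁ h₂ h₃ f hsym hVP
  obtain ⟨c, hc⟩ := h₁ f hsym hVP
  refine ⟨c + 3, fun n => ?_⟩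
  rcases Nat.eq_zero_or_pos n with rfl | hn
  · -- `n = 0`: no variables, `f 0` is the constant `coeff 0 (f 0)`
    obtain ⟨G, inst, C, hC, hev, horb⟩ :=
      h₃ 0 0 0 (PatternExpr.const (MvPolynomial.coeff 0 (f 0)))
    refine ⟨G, inst, C, hC, ?_, horb.trans (le_trans (by norm_num) Nat.one_le_two_pow)⟩
    rw [hev, narrowExpansion_close_const]
    exact (MvPolynomial.eq_C_of_isEmpty (f 0)).symm
  · -- `n ≥ 1`: span certificate → one expression with `W = (log₂ n + c)^c + 1` labels a side → circuit
    obtain ⟨e, he⟩ := narrowExpansion_exists_expr h₂ n ((Nat.log 2 n + c) ^ c) hn (f n) (hc n)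
    obtain ⟨G, inst, C, hC, hev, horb⟩ :=
      h₃ n ((Nat.log 2 n + c) ^ c + 1) ((Nat.log 2 n + c) ^ c + 1) e
    exact ⟨G, inst, C, hC, by rw [hev, he], horb.trans (narrowExpansion_orbit_bound n c)⟩

end Summit.ValiantsHypothesis.ValiantsHypothesis.Theorems
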